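import Summits.CriticalPhenomena.PercolationContinuityZ3.Theorems.PercNearOneGluingAdditiveGluingBhkMenu
import Summits.CriticalPhenomena.PercolationContinuityZ3.Theorems.PercNearOneGluingAdditiveGluingBhkSets
import Summits.CriticalPhenomena.PercolationContinuityZ3.Theorems.PercNearOneGluingAdditiveGluingDiagPtTwo
import HarnessLib

/-! # Crux `PercNearOneGluing.AdditiveGluing` (stmt-CriticalPhenomena-4576), line `tieline`
(skeleton v12) — stub `stub_diagJoinedTwo_c7` (BHK Thm. 1.3 diagonal atom, `S = {s, t}`, `X = {x}`,
"ANY" literal on the `o` side against the "S joined" literal `{s ↔ t}`)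

Helper file for the crux skeleton of the line `tieline` (lead
prover-line-stmt-CriticalPhenomena-4576-c7-0): proves exactly the registered stub signature
`stub_diagJoinedTwo_c7`; lands with `--supports stmt-CriticalPhenomena-4576`.

## Content

Finite weighted graph on `Fin n` (`μ = prodBernoulli w` on `BondConfig (Fin n)`, events
`{u ↔ v} = openConn u v`), two relays `s, t` both different from `x`, a point `o`, and the
decreasing separation event `N := {s ↮ x} ∩ {t ↮ x} = (openConn s x)ᶜ ∩ (openConn t x)ᶜ`
(the cluster `C_{{s,t}} = C_s ∪ C_t` does not contain `x`).  Then

`μ(N ∩ ({s ↔ o} ∪ {t ↔ o})) · μ(N ∩ {s ↔ t}) ≤ μ(N) · μ(N ∩ (({s ↔ o} ∪ {t ↔ o}) ∩ {s ↔ t}))`,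

i.e. given `N` the two increasing functions `1{o ∈ C_{{s,t}}}` and `1{s ↔ t}` ("the set `S` is
joined") of the cluster `C_{{s,t}}` are positively correlated (van den Berg–Häggström–Kahn 2006,
Thm. 1.3, for the cluster of a vertex SET).  The "S joined" literal `{C | s ↔ t in C}` is the point
literal `{C | s ↔ b in C}` of the source point `s ∈ S` at the target `b := t`, so this is verbatim
the instance `b := t` of the landed diagonal atom `stub_diagPtTwo_c7`
(file `…AdditiveGluingDiagPtTwo`, itself the instance `S := {s, t}`, `X := {x}`,
`𝓕 := {C | ∃ s' ∈ {s, t}, s' ↔ o in C}`, `𝓖 := {C | s ↔ b in C}` of the landed generic menu lemma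
`bhkMenu_one` with `hB1 := stub_bhkSets.1`).
-/

namespace Summit.CriticalPhenomena.PercolationContinuityZ3.Theorems

open MeasureTheory Set Literature.Probability.LatticeModels Literature.Probability.Percolation

noncomputable section
open Classical

/-- **BHK 2006 Thm. 1.3, diagonal atom for the cluster of `S = {s, t}` given `{s, t} ↮ x`
(ANY literal `{s ↔ o} ∪ {t ↔ o}` against the "S joined" literal `{s ↔ t}`):** for `s ≠ x`, `t ≠ x`
and `N = {s ↮ x} ∩ {t ↮ x}`,
`μ(N ∩ ({s ↔ o} ∪ {t ↔ o})) μ(N ∩ {s ↔ t}) ≤ μ(N) μ(N ∩ (({s ↔ o} ∪ {t ↔ o}) ∩ {s ↔ t}))`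
— the instance `b := t` of the landed `stub_diagPtTwo_c7` (point literal `{s ↔ b}` of the source
`s ∈ S`), i.e. of `bhkMenu_one` with `hB1 := stub_bhkSets.1`, `S := {s, t}`, `X := {x}`.
[cite: VandenbergHaggstromKahn2005, Thm. 1.3 (p. 6)] -/
theorem stub_diagJoinedTwo_c7 : ∀ (n : ℕ) (w : Sym2 (Fin n) → unitInterval) (s t x o : Fin n), s ≠ x → t ≠ x → (prodBernoulli w).real ((openConn s x)ᶜ ∩ (openConn t x)ᶜ ∩ (openConn s o ∪ openConn t o)) * (prodBernoulli w).real ((openConn s x)ᶜ ∩ (openConn t x)ᶜ ∩ openConn s t) ≤ (prodBernoulli w).real ((openConn s x)ᶜ ∩ (openConn t x)ᶜ) * (prodBernoulli w).real ((openConn s x)ᶜ ∩ (openConn t x)ᶜ ∩ ((openConn s o ∪ openConn t o) ∩ openConn s t)) := by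
  intro n w s t x o hsx htx
  -- adapted from `stub_diagPtTwo_c7` (…DiagPtTwo): the "S joined" literal is its point literal at `b := t`
  exact stub_diagPtTwo_c7 n w s t x o t hsx htx

end

end Summit.CriticalPhenomena.PercolationContinuityZ3.Theorems
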